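import Summits.QuantumFields.YangMills.Theorems.UnitScaleTiltProp7QkWeightConjugation
import HarnessLib

/-!
# Route `UnitScaleTilt`, crux K1 «MinimiserStabilityRegPr» (stmt-QuantumFields-19200), EX rows `h137kπ` ∕ `h137kΔ` ∕ `hCk` — **K-STOREY BRICK (K2b-δ₃)-B (px12 g17, LOCATE-K137 529f36ee road
# (K2)), FILE B1 OF 2: THE BILINEAR CONJUGATION DEFECT OF `V = Δ_a − D†D` AT THE MEMBER, PIECES (Q) AND (P)** — toward the letter `hVconj₂` of ✓∕⧗`Prop7OneFormConjugateResolvent.norm_conj_resolvent_sub_le` ((K2b-δ₃)-A):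
# for TWO bond fields `X′`, `X″` and a positive site weight `w`,
# `|re([⟪toL2(w·X′), Δ_a toL2(w⁻¹·X″)⟫ − Σ_μ⟪D(w·X′)_μ, D(w⁻¹·X″)_μ⟫] − [⟪toL2 X′, Δ_a toL2 X″⟫ − Σ_μ⟪DX′_μ, DX″_μ⟫])| ≤ θ₂·‖toL2 X′‖·‖toL2 X″‖` — the BILINEAR twins of px21 g14's
# A2 pieces: (Q) the averaging penalty (A2b ✓`abs_re_inner_Qk_conj_sub_le`), (P) the `D(1−R_S)D*` kernel (A2a ✓`abs_re_inner_conj_kernel_sub_le`, Schur), (L) the local pair (A2d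
# ✓`abs_re_inner_local_conj_le`, Schur on the radius-2 ball — CRUDE `O(ε₀)` edition: the two local pairings are bounded separately), (S) the slot (hypothesis; `0` at `DeltaEtaSlot`),
# assembled through A2a ✓`inner_laplaceA_eq₂` (the Kato pairings cancel).

Cell `ym3-torus` (HUMAN RULING D-0037: SU(2) YM₃ on T³ is ladder rung R3 — NOT d = 4, NOT infinite volume, NOT a mass gap, NOT Clay).  Width seat `ym3-torus-px12` gen 17.  THEOREMS ONLY
(0 `def`, 0 `sorry`, default heartbeats); `--supports stmt-QuantumFields-19200 --as helper`, count-neutral.  HONEST LABEL: bilinear re-readings of px21 g14's A2a∕A2b∕A2d Schur∕Parseval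
estimates with the SAME letters (`hk` = the EX row `h349`'s kernel text with a free `Ck`, `hwfar`, `hρQ`, `hρ`, `RegPr` + routeR-w4's windows) and the same constants; the (L) piece is the
crude sum of the two local pairings (`θ_L = 32√2ε₀·d6^d·(1 + (1+ρ)²)`, `O(ε₀)`, NOT `O(ρ)`: so `δ₃ = O(r) + O(ε₀)` downstream and (K2)'s `R < m₀` costs one more `ε₀ ≤ α_K(L)` window);
nothing of (3.46)∕(3.132), `h137kπ`, `h137kΔ`, `hCk`, EX or 19200 is proved here.

WHAT IS PROVED (ns `Summit.QuantumFields.YangMills.Theorems.Prop7OneFormAgmonBilinear`; member `F`, `h : n ≤ K`, weights `c₀ cB`, slot `Δx`, coupling `a`).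
* §1 ★ `abs_sum_sum_mul_le_of_row_le` — bilinear Schur: `K ≥ 0` symmetric, row sums `≤ R` ⟹ `|Σ_{ij}K_{ij}f_ig_j| ≤ R·√(Σf²)·√(Σg²)` (discrete Cauchy–Schwarz over `ι × ι`).
* §2 ★★ `norm_inner_Qk_conj_sub_le₂` — (Q): `‖⟪Q_k(w·X′), Q_k(w⁻¹·X″)⟫ − ⟪Q_kX′, Q_kX″⟫‖ ≤ √κ²·(‖Q_kX′‖‖X″‖ + ‖X′‖‖Q_kX″‖) + κ²‖X′‖‖X″‖`, `κ² = 216ρ_Q²(cB∕(c₀ℓ³))`.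
* §3 ★★ `norm_inner_conj_kernel_sub_le₂` — (P): `‖⟪w·X′, B(w⁻¹·X″)⟫ − ⟪X′, BX″⟫‖ ≤ √2·Ck·θc·(d(L^d)^{K−n}(2(1+1∕(μ′−ν)))³)·‖X′‖‖X″‖`.
* (sequel FILE B2 ✓∕⧗`Prop7OneFormAgmonBilinearExport`: §4 the (L) pieces, §5 ★★★ `hVconj₂_of_letters` — THE LETTER ABOVE with `θ₂ = a·(2√κ²C_Q + κ²) + √2·Ck·θc·(…) + θ_S + 32√2ε₀·d6^d·(1 + (1+ρ)²)`.)
HYP-SAT (★★OWNER RULING №42): exactly A2c's hypotheses (inhabited as there: `hk` ⟸ h349 ✓`kernelRow349_allMembers_exists` under Lift, `hQ` ⟸ ✓`norm_Qk_le_of_regPr`, `hwfar`∕`hρQ`∕`hρ` ⟸ A2e for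
`w = e^{φ}`); nothing eventual; no hypothesis restates the conclusion.

References: T. Bałaban, CMP **99** (1985) 389–434 [Balaban1985BackgroundPropagators] ((3.11)–(3.16) pp.392–393, (3.26) p.395, Thm 3.1 (3.46) p.398, (3.49) p.399, (3.132) p.422);
CMP **102** (1985) 277–309 [Balaban1985Variational] ((134)–(136) p.298); S. Agmon, *Lectures on exponential decay* (Princeton 1982) Ch. 1 [Agmon1982].
-/

set_option autoImplicit false

noncomputable section

open scoped BigOperators Matrix.Norms.L2Operator InnerProductSpace ComplexConjugate

namespace Summit.QuantumFields.YangMills.Theorems.Prop7OneFormAgmonBilinear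

open Literature.MathematicalPhysics.QuantumFieldTheory.Balaban1983to89
open Literature.MathematicalPhysics.QuantumFieldTheory.Balaban1983to89.T3ContinuumYM3Torus
open T3SectALandauChart (eta eta_pos bgUnits formComp)
open T3PrintedRegularMinimiser (RegPr)
open T3PrintedRegularOrbits (sites_eq)
open T3LevelShift (bondShift)
open B9TorusCalculus (torusT)
open B9Eq310Hermitian (deltaPrimeOp)
open B11Eq135Weitzenbock (curvOp)
open B11Eq103H1Complex (SiteL2K BondL2K)
open B9Eq311L2Pairing (WL2)
open B5Eq118OneStroke (iterBlockOf)
open B3Taylor310LocalRemainder (tdist_comm)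
open Summit.QuantumFields.YangMills.Theorems.Prop7SectET3Transport (periodsT3)
open Summit.QuantumFields.YangMills.Theorems.Prop7SectET3HilbertLetters (W₂ frobEquiv toL2 toL2S toL2B DL2 DstarL2 inner_toL2 inner_toL2B inner_frobEquiv_symm)
open Summit.QuantumFields.YangMills.Theorems.Prop7SectET3WilsonHessian (DeltaEta DeltaEtaSlot)
open Summit.QuantumFields.YangMills.Theorems.Prop7SectET3GaugeProjector (RS)
open Summit.QuantumFields.YangMills.Theorems.Prop7SectET3CurvedPropagators (laplaceA Qk)
open Summit.QuantumFields.YangMills.Theorems.Prop7SymAvgTwSym (QTwS)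
open Summit.QuantumFields.YangMills.Theorems.Prop7TransverseRowOfTubeRowRegPr (Qk_toL2)
open Summit.QuantumFields.YangMills.Theorems.Prop7RieszTauFrobNorm (norm_sq_frobEquiv_symm norm_le_norm_frobEquiv_symm norm_frobEquiv_symm_le)
open Summit.QuantumFields.YangMills.Theorems.Prop7LaplaceAFlatLetters (norm_sq_toL2)
open Summit.QuantumFields.YangMills.Theorems.Prop7BlockDistanceWeights (tdist_coarse_comm)
open Summit.QuantumFields.YangMills.Theorems.Prop7OneFormAgmonLetters (inner_laplaceA_eq₂ sum_pbond_exp_neg_mul_tdist_le)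
open Summit.QuantumFields.YangMills.Theorems.Prop7OneFormAgmonAveraging (Qk_toL2_smul_eq_ref sum_normSq_entries_QTwS_relComm_le inner_toL2B_smul_smul_inv)
open Summit.QuantumFields.YangMills.Theorems.Prop7OneFormAgmonLocal (norm_local_conj_le_of_regPr sum_pbond_ball_indicator_le)
open Summit.QuantumFields.YangMills.Theorems.Prop7QkWeightConjugation (norm_eta_smul_toL2B_le)

/-! ## §1 Bilinear Schur -/

/-- ★ **SCHUR's TEST, bilinear edition**: `K ≥ 0` symmetric with row sums `≤ R` (`0 ≤ R`) ⟹ `|Σ_{ij} K_{ij}·f_i·g_j| ≤ R·√(Σ_i f_i²)·√(Σ_j g_j²)`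
(Cauchy–Schwarz over `ι × ι` with `√K_{ij}f_i`, `√K_{ij}g_j`; the row∕column sums by symmetry). [folklore] -/
theorem abs_sum_sum_mul_le_of_row_le {ι : Type*} [Fintype ι] (Kf : ι → ι → ℝ) (hK0 : ∀ i j, 0 ≤ Kf i j) (hsymm : ∀ i j, Kf i j = Kf j i)
    {Rr : ℝ} (hR : 0 ≤ Rr) (hrow : ∀ i, ∑ j, Kf i j ≤ Rr) (f g : ι → ℝ) :
    |∑ i, ∑ j, Kf i j * (f i * g j)| ≤ Rr * Real.sqrt (∑ i, f i ^ 2) * Real.sqrt (∑ i, g i ^ 2) := by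
  -- Cauchy–Schwarz over the product index
  have hcs : (∑ i, ∑ j, Kf i j * (f i * g j)) ^ 2 ≤ (∑ i, ∑ j, Kf i j * f i ^ 2) * (∑ i, ∑ j, Kf i j * g j ^ 2) := by
    have h := Finset.sum_mul_sq_le_sq_mul_sq (Finset.univ : Finset (ι × ι)) (fun p => Real.sqrt (Kf p.1 p.2) * f p.1) (fun p => Real.sqrt (Kf p.1 p.2) * g p.2)
    have e0 : ∑ p : ι × ι, Real.sqrt (Kf p.1 p.2) * f p.1 * (Real.sqrt (Kf p.1 p.2) * g p.2) = ∑ i, ∑ j, Kf i j * (f i * g j) := by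
      rw [Fintype.sum_prod_type]
      refine Finset.sum_congr rfl fun i _ => Finset.sum_congr rfl fun j _ => ?_
      have := Real.mul_self_sqrt (hK0 i j)
      calc Real.sqrt (Kf i j) * f i * (Real.sqrt (Kf i j) * g j) = (Real.sqrt (Kf i j) * Real.sqrt (Kf i j)) * (f i * g j) := by ring
        _ = Kf i j * (f i * g j) := by rw [this]
    have e1 : ∑ p : ι × ι, (Real.sqrt (Kf p.1 p.2) * f p.1) ^ 2 = ∑ i, ∑ j, Kf i j * f i ^ 2 := by
      rw [Fintype.sum_prod_type]
      refine Finset.sum_congr rfl fun i _ => Finset.sum_congr rfl fun j _ => ?_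
      rw [mul_pow, Real.sq_sqrt (hK0 i j)]
    have e2 : ∑ p : ι × ι, (Real.sqrt (Kf p.1 p.2) * g p.2) ^ 2 = ∑ i, ∑ j, Kf i j * g j ^ 2 := by
      rw [Fintype.sum_prod_type]
      refine Finset.sum_congr rfl fun i _ => Finset.sum_congr rfl fun j _ => ?_
      rw [mul_pow, Real.sq_sqrt (hK0 i j)]
    rw [e0, e1, e2] at h
    exact h
  -- row sums and (by symmetry) column sums
  have hA : ∑ i, ∑ j, Kf i j * f i ^ 2 ≤ Rr * ∑ i, f i ^ 2 := by
    rw [Finset.mul_sum]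
    refine Finset.sum_le_sum fun i _ => ?_
    rw [← Finset.sum_mul]
    exact mul_le_mul_of_nonneg_right (hrow i) (sq_nonneg _)
  have hB : ∑ i, ∑ j, Kf i j * g j ^ 2 ≤ Rr * ∑ j, g j ^ 2 := by
    rw [Finset.sum_comm, Finset.mul_sum]
    refine Finset.sum_le_sum fun j _ => ?_
    rw [← Finset.sum_mul]
    refine mul_le_mul_of_nonneg_right ?_ (sq_nonneg _)
    calc ∑ i, Kf i j = ∑ i, Kf j i := Finset.sum_congr rfl fun i _ => hsymm i j
      _ ≤ Rr := hrow j
  have hF0 : 0 ≤ ∑ i, f i ^ 2 := Finset.sum_nonneg fun i _ => sq_nonneg _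
  have hG0 : 0 ≤ ∑ j, g j ^ 2 := Finset.sum_nonneg fun j _ => sq_nonneg _
  have hA0 : 0 ≤ ∑ i, ∑ j, Kf i j * f i ^ 2 := Finset.sum_nonneg fun i _ => Finset.sum_nonneg fun j _ => mul_nonneg (hK0 i j) (sq_nonneg _)
  have hsq : (∑ i, ∑ j, Kf i j * (f i * g j)) ^ 2 ≤ (Rr * Real.sqrt (∑ i, f i ^ 2) * Real.sqrt (∑ i, g i ^ 2)) ^ 2 := by
    calc (∑ i, ∑ j, Kf i j * (f i * g j)) ^ 2 ≤ (∑ i, ∑ j, Kf i j * f i ^ 2) * (∑ i, ∑ j, Kf i j * g j ^ 2) := hcs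
      _ ≤ (Rr * ∑ i, f i ^ 2) * (Rr * ∑ j, g j ^ 2) := mul_le_mul hA hB (Finset.sum_nonneg fun i _ => Finset.sum_nonneg fun j _ => mul_nonneg (hK0 i j) (sq_nonneg _)) (by positivity)
      _ = (Rr * Real.sqrt (∑ i, f i ^ 2) * Real.sqrt (∑ i, g i ^ 2)) ^ 2 := by
          rw [mul_pow, mul_pow, Real.sq_sqrt hF0, Real.sq_sqrt hG0]; ring
  exact abs_le_of_sq_le_sq' hsq (by positivity) |>.2 |> fun h2 => abs_le.mpr ⟨(abs_le_of_sq_le_sq' hsq (by positivity)).1, h2⟩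

/-! ## §2 (Q) The averaging penalty under reciprocal weights, bilinear -/

section Q

variable (F : T3Family) {n K : ℕ} (h : n ≤ K) (c₀ cB : ℝ) [Fact (0 < c₀)] [Fact (0 < cB)]

/-- ★★ **THE (Q) PIECE, BILINEAR**: `RegPr F n K ε₀ U₀` + routeR-w4's windows; a positive site weight with both read-set ratios `≤ ρ_Q` (reference sites `x_r`).  With
`κ² := 216ρ_Q²(cB∕(c₀ℓ³))`, for all bond fields `X′`, `X″`:
`‖⟪Q_k(toL2(w(b₋)·X′)), Q_k(toL2(w(b₋)⁻¹·X″))⟫ − ⟪Q_k(toL2 X′), Q_k(toL2 X″)⟫‖ ≤ √κ²·(‖Q_k(toL2 X′)‖·‖toL2 X″‖ + ‖toL2 X′‖·‖Q_k(toL2 X″)‖) + κ²·‖toL2 X′‖·‖toL2 X″‖`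
(A2b's split `Q_k(toL2(w·X)) = toL2B(w(x_r ĉ)·η·(QTwS X + E))`, the reciprocal block weights pair to the identity, ✓`norm_eta_smul_toL2B_le`).
[cite: Balaban1985BackgroundPropagators, (3.13)–(3.16) p.393, Thm 3.1 (3.46) p.398; Balaban1985Variational, (44)–(45) p.285] -/
theorem norm_inner_Qk_conj_sub_le₂ {ε₀ : ℝ} (hε₀ : 0 < ε₀) (hε : 10 ^ 10 * (F.L : ℝ) ^ 6 * ε₀ ≤ 1) (hε12 : 10 ^ 12 * (F.L : ℝ) ^ 3 * ε₀ ≤ 1)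
    (U₀ : GaugeField (F.P K) 0 (Matrix.specialUnitaryGroup (Fin 2) ℂ)) (hreg : RegPr F n K ε₀ U₀)
    (w : Site (F.P K) 0 → ℝ) (hw : ∀ x, 0 < w x) (xr : PBond (F.P n) 0 → Site (F.P K) 0) {ρQ : ℝ}
    (hρQ : ∀ (c : PBond (F.P n) 0) (b : PBond (F.P K) 0),
      (iterBlockOf (K - n) b.src = (bondShift (sites_eq F n K h) c).src ∨ iterBlockOf (K - n) b.src = (bondShift (sites_eq F n K h) c).tgt) →
      |w b.src / w (xr c) - 1| ≤ ρQ ∧ |w (xr c) / w b.src - 1| ≤ ρQ)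
    (X' X'' : PBond (F.P K) 0 → Matrix (Fin 2) (Fin 2) ℂ) :
    ‖⟪Qk F n K h c₀ cB U₀ (toL2 F K c₀ (fun b => w b.src • X' b)), Qk F n K h c₀ cB U₀ (toL2 F K c₀ (fun b => (w b.src)⁻¹ • X'' b))⟫_ℂ
        - ⟪Qk F n K h c₀ cB U₀ (toL2 F K c₀ X'), Qk F n K h c₀ cB U₀ (toL2 F K c₀ X'')⟫_ℂ‖
      ≤ Real.sqrt (216 * ρQ ^ 2 * (cB / (c₀ * ((F.L : ℝ) ^ (K - n)) ^ 3)))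
          * (‖Qk F n K h c₀ cB U₀ (toL2 F K c₀ X')‖ * ‖toL2 F K c₀ X''‖ + ‖toL2 F K c₀ X'‖ * ‖Qk F n K h c₀ cB U₀ (toL2 F K c₀ X'')‖)
        + 216 * ρQ ^ 2 * (cB / (c₀ * ((F.L : ℝ) ^ (K - n)) ^ 3)) * ‖toL2 F K c₀ X'‖ * ‖toL2 F K c₀ X''‖ := by
  have hw0 : ∀ x, w x ≠ 0 := fun x => (hw x).ne'
  have hxr : ∀ c, w (xr c) ≠ 0 := fun c => hw0 _
  have hxri : ∀ c, (fun x => (w x)⁻¹) (xr c) ≠ 0 := fun c => inv_ne_zero (hw0 _)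
  -- the two splits
  set G' : PBond (F.P n) 0 → Matrix (Fin 2) (Fin 2) ℂ := QTwS F n K h U₀ X' with hG'
  set G'' : PBond (F.P n) 0 → Matrix (Fin 2) (Fin 2) ℂ := QTwS F n K h U₀ X'' with hG''
  set E' : PBond (F.P n) 0 → Matrix (Fin 2) (Fin 2) ℂ := fun c =>
    QTwS F n K h U₀ (fun b : PBond (F.P K) 0 => (((w b.src / w (xr c) - 1 : ℝ)) : ℂ) • X' b) c with hE'
  set E'' : PBond (F.P n) 0 → Matrix (Fin 2) (Fin 2) ℂ := fun c =>
    QTwS F n K h U₀ (fun b : PBond (F.P K) 0 => ((((fun x => (w x)⁻¹) b.src / (fun x => (w x)⁻¹) (xr c) - 1 : ℝ)) : ℂ) • X'' b) c with hE''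
  have h1 : Qk F n K h c₀ cB U₀ (toL2 F K c₀ (fun b => w b.src • X' b)) = toL2B F n cB (fun c => w (xr c) • (((eta F n K : ℝ) : ℂ) • (G' c + E' c))) :=
    Qk_toL2_smul_eq_ref F h c₀ cB U₀ w xr hxr X'
  have h2 : Qk F n K h c₀ cB U₀ (toL2 F K c₀ (fun b => (w b.src)⁻¹ • X'' b)) = toL2B F n cB (fun c => (w (xr c))⁻¹ • (((eta F n K : ℝ) : ℂ) • (G'' c + E'' c))) :=
    Qk_toL2_smul_eq_ref F h c₀ cB U₀ (fun x => (w x)⁻¹) xr hxri X''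
  set a' := Qk F n K h c₀ cB U₀ (toL2 F K c₀ X') with ha'
  set a'' := Qk F n K h c₀ cB U₀ (toL2 F K c₀ X'') with ha''
  set k' := ((eta F n K : ℝ) : ℂ) • toL2B F n cB E' with hk'
  set k'' := ((eta F n K : ℝ) : ℂ) • toL2B F n cB E'' with hk''
  have haG' : a' = ((eta F n K : ℝ) : ℂ) • toL2B F n cB G' := by rw [ha', Qk_toL2]
  have haG'' : a'' = ((eta F n K : ℝ) : ℂ) • toL2B F n cB G'' := by rw [ha'', Qk_toL2]
  have hsum' : toL2B F n cB (fun c => ((eta F n K : ℝ) : ℂ) • (G' c + E' c)) = a' + k' := by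
    rw [haG', hk', ← smul_add, ← map_add, ← map_smul]; rfl
  have hsum'' : toL2B F n cB (fun c => ((eta F n K : ℝ) : ℂ) • (G'' c + E'' c)) = a'' + k'' := by
    rw [haG'', hk'', ← smul_add, ← map_add, ← map_smul]; rfl
  have hpair : ⟪Qk F n K h c₀ cB U₀ (toL2 F K c₀ (fun b => w b.src • X' b)), Qk F n K h c₀ cB U₀ (toL2 F K c₀ (fun b => (w b.src)⁻¹ • X'' b))⟫_ℂ = ⟪a' + k', a'' + k''⟫_ℂ := by
    rw [h1, h2, inner_toL2B_smul_smul_inv F cB (fun c => w (xr c)) hxr, hsum', hsum'']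
  -- the defect norms
  set κ2 : ℝ := 216 * ρQ ^ 2 * (cB / (c₀ * ((F.L : ℝ) ^ (K - n)) ^ 3)) with hκ2
  have hκ2_0 : 0 ≤ κ2 := by
    have : 0 < c₀ := Fact.out
    have : 0 < cB := Fact.out
    have : (0 : ℝ) < (F.L : ℝ) ^ (K - n) := pow_pos (by exact_mod_cast lt_trans zero_lt_one F.hL.2) _
    positivity
  have hkn' : ‖k'‖ ≤ Real.sqrt κ2 * ‖toL2 F K c₀ X'‖ :=
    norm_eta_smul_toL2B_le F c₀ cB E' X' (sum_normSq_entries_QTwS_relComm_le F n K h hε₀ hε hε12 U₀ hreg w xr (fun c b hb => (hρQ c b hb).1) X')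
  have hkn'' : ‖k''‖ ≤ Real.sqrt κ2 * ‖toL2 F K c₀ X''‖ := by
    refine norm_eta_smul_toL2B_le F c₀ cB E'' X'' (sum_normSq_entries_QTwS_relComm_le F n K h hε₀ hε hε12 U₀ hreg (fun x => (w x)⁻¹) xr (fun c b hb => ?_) X'')
    simp only [inv_div_inv]
    exact (hρQ c b hb).2
  -- expand and bound
  have hexp : ⟪a' + k', a'' + k''⟫_ℂ - ⟪a', a''⟫_ℂ = ⟪a', k''⟫_ℂ + ⟪k', a''⟫_ℂ + ⟪k', k''⟫_ℂ := by
    rw [inner_add_left, inner_add_right, inner_add_right]; ring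
  rw [hpair, hexp]
  have t1 : ‖⟪a', k''⟫_ℂ‖ ≤ ‖a'‖ * (Real.sqrt κ2 * ‖toL2 F K c₀ X''‖) := (norm_inner_le_norm _ _).trans (mul_le_mul_of_nonneg_left hkn'' (norm_nonneg _))
  have t2 : ‖⟪k', a''⟫_ℂ‖ ≤ (Real.sqrt κ2 * ‖toL2 F K c₀ X'‖) * ‖a''‖ := (norm_inner_le_norm _ _).trans (mul_le_mul_of_nonneg_right hkn' (norm_nonneg _))
  have t3 : ‖⟪k', k''⟫_ℂ‖ ≤ (Real.sqrt κ2 * ‖toL2 F K c₀ X'‖) * (Real.sqrt κ2 * ‖toL2 F K c₀ X''‖) :=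
    (norm_inner_le_norm _ _).trans (mul_le_mul hkn' hkn'' (norm_nonneg _) (by positivity))
  calc ‖⟪a', k''⟫_ℂ + ⟪k', a''⟫_ℂ + ⟪k', k''⟫_ℂ‖ ≤ ‖⟪a', k''⟫_ℂ‖ + ‖⟪k', a''⟫_ℂ‖ + ‖⟪k', k''⟫_ℂ‖ := norm_add₃_le
    _ ≤ ‖a'‖ * (Real.sqrt κ2 * ‖toL2 F K c₀ X''‖) + (Real.sqrt κ2 * ‖toL2 F K c₀ X'‖) * ‖a''‖ + (Real.sqrt κ2 * ‖toL2 F K c₀ X'‖) * (Real.sqrt κ2 * ‖toL2 F K c₀ X''‖) :=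
        add_le_add (add_le_add t1 t2) t3
    _ = Real.sqrt κ2 * (‖a'‖ * ‖toL2 F K c₀ X''‖ + ‖toL2 F K c₀ X'‖ * ‖a''‖) + Real.sqrt κ2 ^ 2 * ‖toL2 F K c₀ X'‖ * ‖toL2 F K c₀ X''‖ := by ring
    _ = Real.sqrt κ2 * (‖a'‖ * ‖toL2 F K c₀ X''‖ + ‖toL2 F K c₀ X'‖ * ‖a''‖) + κ2 * ‖toL2 F K c₀ X'‖ * ‖toL2 F K c₀ X''‖ := by rw [Real.sq_sqrt hκ2_0]

end Q

/-! ## §3 (P) The Schur letter for a kernel decaying in the block distance, bilinear -/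

section P

variable (F : T3Family) {n K : ℕ} {c₀ : ℝ} [Fact (0 < c₀)]

/-- ★★ **THE (P) PIECE, BILINEAR**: for ANY linear `B` on the fine vector fields with the displayed pointwise kernel row `hk` (the EX row `h349`'s member text with a free `Ck`, rate `μ′`)
and a weight whose far ratios grow slower than the kernel decays (`hwfar`, rate `ν < μ′`), for all `X′`, `X″`:
`‖⟪toL2(w(b₋)·X′), B(toL2(w(b₋)⁻¹·X″))⟫ − ⟪toL2 X′, B(toL2 X″)⟫‖ ≤ √2·Ck·θc·(d·(L^d)^{K−n}·(2(1+1∕(μ′−ν)))³)·‖toL2 X′‖·‖toL2 X″‖` — Schur's test (§1) on the kernel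
`(w(bd₋)∕w(b₋) − 1)·k(bd,b)` between TWO fields (the bilinear twin of A2a ✓`abs_re_inner_conj_kernel_sub_le`). [cite: Balaban1985BackgroundPropagators, Thm 3.1 (3.46) p.398, (3.49) p.399] -/
theorem norm_inner_conj_kernel_sub_le₂ (B : BondL2K ℂ 3 (periodsT3 F K) c₀ W₂ →ₗ[ℂ] BondL2K ℂ 3 (periodsT3 F K) c₀ W₂)
    (w : Site (F.P K) 0 → ℝ) {θc ν μ' Ck : ℝ} (hθc : 0 ≤ θc) (hCk : 0 ≤ Ck) (hνμ : ν < μ')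
    (hwfar : ∀ x x' : Site (F.P K) 0, |w x / w x' - 1| ≤ θc * Real.exp (ν * (Site.tdist (P := F.P K) (iterBlockOf (K - n) x) (iterBlockOf (K - n) x') : ℝ)))
    (hk : ∀ (b : PBond (F.P K) 0) (Z : Matrix (Fin 2) (Fin 2) ℂ) (bd : PBond (F.P K) 0),
      ‖(toL2 F K c₀).symm (B (toL2 F K c₀ (Pi.single b Z))) bd‖
        ≤ Ck * Real.exp (-(μ' * (Site.tdist (P := F.P K) (iterBlockOf (K - n) b.src) (iterBlockOf (K - n) bd.src) : ℝ))) * ‖Z‖)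
    (X' X'' : PBond (F.P K) 0 → Matrix (Fin 2) (Fin 2) ℂ) :
    ‖⟪toL2 F K c₀ (fun b => w b.src • X' b), B (toL2 F K c₀ (fun b => (w b.src)⁻¹ • X'' b))⟫_ℂ - ⟪toL2 F K c₀ X', B (toL2 F K c₀ X'')⟫_ℂ‖
      ≤ Real.sqrt 2 * Ck * θc * (((F.P K).d : ℝ) * ((((F.P K).L : ℝ) ^ (F.P K).d) ^ (K - n)) * (2 * (1 + 1 / (μ' - ν))) ^ 3)
        * ‖toL2 F K c₀ X'‖ * ‖toL2 F K c₀ X''‖ := by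
  classical
  have hc₀ : 0 < c₀ := Fact.out
  have hμν : 0 < μ' - ν := sub_pos.mpr hνμ
  -- the kernel readback and its expansion
  have hexp : ∀ (Y : PBond (F.P K) 0 → Matrix (Fin 2) (Fin 2) ℂ) (bd : PBond (F.P K) 0),
      (toL2 F K c₀).symm (B (toL2 F K c₀ Y)) bd = ∑ b, (toL2 F K c₀).symm (B (toL2 F K c₀ (Pi.single b (Y b)))) bd := by
    intro Y bd
    conv_lhs => rw [← Finset.univ_sum_single Y]
    rw [map_sum, map_sum, map_sum, Finset.sum_apply]
  have hlin : ∀ (r : ℝ) (b : PBond (F.P K) 0) (Z : Matrix (Fin 2) (Fin 2) ℂ) (bd : PBond (F.P K) 0),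
      (toL2 F K c₀).symm (B (toL2 F K c₀ (Pi.single b (r • Z)))) bd = (r : ℂ) • (toL2 F K c₀).symm (B (toL2 F K c₀ (Pi.single b Z))) bd := by
    intro r b Z bd
    rw [← Complex.coe_smul, Pi.single_smul, map_smul, map_smul, map_smul, Pi.smul_apply]
  have hB : ∀ Y : PBond (F.P K) 0 → Matrix (Fin 2) (Fin 2) ℂ, B (toL2 F K c₀ Y) = toL2 F K c₀ ((toL2 F K c₀).symm (B (toL2 F K c₀ Y))) :=
    fun Y => ((toL2 F K c₀).apply_symm_apply _).symm
  set kk : PBond (F.P K) 0 → PBond (F.P K) 0 → Matrix (Fin 2) (Fin 2) ℂ := fun bd b => (toL2 F K c₀).symm (B (toL2 F K c₀ (Pi.single b (X'' b)))) bd with hkk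
  have hconj : ⟪toL2 F K c₀ (fun b => w b.src • X' b), B (toL2 F K c₀ (fun b => (w b.src)⁻¹ • X'' b))⟫_ℂ
      = (c₀ : ℂ) * ∑ bd, ∑ b, (((w bd.src * (w b.src)⁻¹ : ℝ)) : ℂ) * Matrix.trace ((X' bd).conjTranspose * kk bd b) := by
    rw [hB, inner_toL2]
    congr 1
    refine Finset.sum_congr rfl fun bd _ => ?_
    rw [hexp, Matrix.mul_sum, Matrix.trace_sum]
    refine Finset.sum_congr rfl fun b _ => ?_
    rw [hlin, hkk, ← Complex.coe_smul, Matrix.conjTranspose_smul, Matrix.smul_mul, Matrix.mul_smul, Matrix.trace_smul, Matrix.trace_smul, smul_smul,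
      Complex.star_def, Complex.conj_ofReal, smul_eq_mul]
    push_cast
    ring
  have hplain : ⟪toL2 F K c₀ X', B (toL2 F K c₀ X'')⟫_ℂ = (c₀ : ℂ) * ∑ bd, ∑ b, Matrix.trace ((X' bd).conjTranspose * kk bd b) := by
    rw [hB, inner_toL2]
    congr 1
    refine Finset.sum_congr rfl fun bd _ => ?_
    rw [hexp, Matrix.mul_sum, Matrix.trace_sum]
  have hdiff : ⟪toL2 F K c₀ (fun b => w b.src • X' b), B (toL2 F K c₀ (fun b => (w b.src)⁻¹ • X'' b))⟫_ℂ - ⟪toL2 F K c₀ X', B (toL2 F K c₀ X'')⟫_ℂ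
      = (c₀ : ℂ) * ∑ bd, ∑ b, (((w bd.src / w b.src - 1 : ℝ)) : ℂ) * Matrix.trace ((X' bd).conjTranspose * kk bd b) := by
    rw [hconj, hplain, ← mul_sub, ← Finset.sum_sub_distrib]
    congr 1
    refine Finset.sum_congr rfl fun bd _ => ?_
    rw [← Finset.sum_sub_distrib]
    refine Finset.sum_congr rfl fun b _ => ?_
    rw [div_eq_mul_inv]
    push_cast
    ring
  -- entrywise bound against the symmetric decay kernel
  set f' : PBond (F.P K) 0 → ℝ := fun b => ‖(frobEquiv.symm (X' b) : W₂)‖ with hf'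
  set f'' : PBond (F.P K) 0 → ℝ := fun b => ‖(frobEquiv.symm (X'' b) : W₂)‖ with hf''
  set Kf : PBond (F.P K) 0 → PBond (F.P K) 0 → ℝ := fun bd b =>
    Real.exp (-((μ' - ν) * (Site.tdist (P := F.P K) (iterBlockOf (K - n) bd.src) (iterBlockOf (K - n) b.src) : ℝ))) with hKf
  have hterm : ∀ bd b, ‖(((w bd.src / w b.src - 1 : ℝ)) : ℂ) * Matrix.trace ((X' bd).conjTranspose * kk bd b)‖
      ≤ Real.sqrt 2 * Ck * θc * (Kf bd b * (f' bd * f'' b)) := by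
    intro bd b
    rw [norm_mul, Complex.norm_real, Real.norm_eq_abs, ← inner_frobEquiv_symm]
    have h1 : ‖⟪(frobEquiv.symm (X' bd) : W₂), frobEquiv.symm (kk bd b)⟫_ℂ‖ ≤ f' bd * ‖(frobEquiv.symm (kk bd b) : W₂)‖ := norm_inner_le_norm _ _
    have h2 : ‖(frobEquiv.symm (kk bd b) : W₂)‖ ≤ Real.sqrt 2 * (Ck * Real.exp (-(μ' * (Site.tdist (P := F.P K) (iterBlockOf (K - n) b.src) (iterBlockOf (K - n) bd.src) : ℝ))) * f'' b) := by
      refine (norm_frobEquiv_symm_le _).trans (mul_le_mul_of_nonneg_left ?_ (Real.sqrt_nonneg _))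
      exact (hk b (X'' b) bd).trans (mul_le_mul_of_nonneg_left (norm_le_norm_frobEquiv_symm _) (by positivity))
    have h3 := hwfar bd.src b.src
    have hf0 : 0 ≤ f' bd := norm_nonneg _
    have hfb : 0 ≤ f'' b := norm_nonneg _
    have hprod : |w bd.src / w b.src - 1| * ‖⟪(frobEquiv.symm (X' bd) : W₂), frobEquiv.symm (kk bd b)⟫_ℂ‖
        ≤ (θc * Real.exp (ν * (Site.tdist (P := F.P K) (iterBlockOf (K - n) bd.src) (iterBlockOf (K - n) b.src) : ℝ)))
          * (f' bd * (Real.sqrt 2 * (Ck * Real.exp (-(μ' * (Site.tdist (P := F.P K) (iterBlockOf (K - n) b.src) (iterBlockOf (K - n) bd.src) : ℝ))) * f'' b))) :=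
      mul_le_mul h3 (h1.trans (mul_le_mul_of_nonneg_left h2 hf0)) (by positivity) (by positivity)
    refine hprod.trans (le_of_eq ?_)
    rw [hKf, tdist_coarse_comm F (iterBlockOf (K - n) b.src)]
    simp only
    rw [show -((μ' - ν) * (Site.tdist (P := F.P K) (iterBlockOf (K - n) bd.src) (iterBlockOf (K - n) b.src) : ℝ))
        = ν * (Site.tdist (P := F.P K) (iterBlockOf (K - n) bd.src) (iterBlockOf (K - n) b.src) : ℝ)
          + -(μ' * (Site.tdist (P := F.P K) (iterBlockOf (K - n) bd.src) (iterBlockOf (K - n) b.src) : ℝ)) by ring, Real.exp_add]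
    ring
  -- Schur, bilinear
  have hrow : ∀ bd, ∑ b, Kf bd b ≤ ((F.P K).d : ℝ) * ((((F.P K).L : ℝ) ^ (F.P K).d) ^ (K - n)) * (2 * (1 + 1 / (μ' - ν))) ^ 3 := fun bd => by
    rw [hKf]; exact sum_pbond_exp_neg_mul_tdist_le F hμν bd.src
  have hR0 : 0 ≤ ((F.P K).d : ℝ) * ((((F.P K).L : ℝ) ^ (F.P K).d) ^ (K - n)) * (2 * (1 + 1 / (μ' - ν))) ^ 3 := by
    have := (F.P K).L_pos; positivity
  have hschur := abs_sum_sum_mul_le_of_row_le Kf (fun _ _ => (Real.exp_pos _).le)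
    (fun bd b => by rw [hKf]; simp only; rw [tdist_coarse_comm F]) hR0 hrow f' f''
  have hnormX' : ‖toL2 F K c₀ X'‖ = Real.sqrt c₀ * Real.sqrt (∑ b, f' b ^ 2) := by
    have h2 : ‖toL2 F K c₀ X'‖ ^ 2 = c₀ * ∑ b, f' b ^ 2 := by
      rw [norm_sq_toL2]; congr 1; exact Finset.sum_congr rfl fun b _ => (norm_sq_frobEquiv_symm (X' b)).symm
    rw [← Real.sqrt_mul hc₀.le, ← h2, Real.sqrt_sq (norm_nonneg _)]
  have hnormX'' : ‖toL2 F K c₀ X''‖ = Real.sqrt c₀ * Real.sqrt (∑ b, f'' b ^ 2) := by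
    have h2 : ‖toL2 F K c₀ X''‖ ^ 2 = c₀ * ∑ b, f'' b ^ 2 := by
      rw [norm_sq_toL2]; congr 1; exact Finset.sum_congr rfl fun b _ => (norm_sq_frobEquiv_symm (X'' b)).symm
    rw [← Real.sqrt_mul hc₀.le, ← h2, Real.sqrt_sq (norm_nonneg _)]
  have hS0 : 0 ≤ ∑ bd, ∑ b, Kf bd b * (f' bd * f'' b) := Finset.sum_nonneg fun bd _ => Finset.sum_nonneg fun b _ => by positivity
  -- assemble
  rw [hdiff]
  calc ‖(c₀ : ℂ) * ∑ bd, ∑ b, (((w bd.src / w b.src - 1 : ℝ)) : ℂ) * Matrix.trace ((X' bd).conjTranspose * kk bd b)‖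
      ≤ c₀ * ∑ bd, ∑ b, Real.sqrt 2 * Ck * θc * (Kf bd b * (f' bd * f'' b)) := by
        rw [norm_mul, Complex.norm_real, Real.norm_of_nonneg hc₀.le]
        refine mul_le_mul_of_nonneg_left ((norm_sum_le _ _).trans (Finset.sum_le_sum fun bd _ => (norm_sum_le _ _).trans (Finset.sum_le_sum fun b _ => hterm bd b))) hc₀.le
    _ = Real.sqrt 2 * Ck * θc * (c₀ * ∑ bd, ∑ b, Kf bd b * (f' bd * f'' b)) := by
        rw [Finset.mul_sum, Finset.mul_sum, Finset.mul_sum]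
        refine Finset.sum_congr rfl fun bd _ => ?_
        rw [Finset.mul_sum, Finset.mul_sum, Finset.mul_sum]
        exact Finset.sum_congr rfl fun b _ => by ring
    _ ≤ Real.sqrt 2 * Ck * θc * (c₀ * ((((F.P K).d : ℝ) * ((((F.P K).L : ℝ) ^ (F.P K).d) ^ (K - n)) * (2 * (1 + 1 / (μ' - ν))) ^ 3)
          * Real.sqrt (∑ b, f' b ^ 2) * Real.sqrt (∑ b, f'' b ^ 2))) := by
        refine mul_le_mul_of_nonneg_left (mul_le_mul_of_nonneg_left ((le_abs_self _).trans hschur) hc₀.le) (by positivity)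
    _ = Real.sqrt 2 * Ck * θc * (((F.P K).d : ℝ) * ((((F.P K).L : ℝ) ^ (F.P K).d) ^ (K - n)) * (2 * (1 + 1 / (μ' - ν))) ^ 3)
        * ‖toL2 F K c₀ X'‖ * ‖toL2 F K c₀ X''‖ := by
        rw [hnormX', hnormX'']
        have e : Real.sqrt c₀ * Real.sqrt c₀ = c₀ := Real.mul_self_sqrt hc₀.le
        calc _ = Real.sqrt 2 * Ck * θc * (((F.P K).d : ℝ) * ((((F.P K).L : ℝ) ^ (F.P K).d) ^ (K - n)) * (2 * (1 + 1 / (μ' - ν))) ^ 3)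
              * ((Real.sqrt c₀ * Real.sqrt c₀) * (Real.sqrt (∑ b, f' b ^ 2) * Real.sqrt (∑ b, f'' b ^ 2))) := by rw [e]; ring
          _ = _ := by ring

end P

end Summit.QuantumFields.YangMills.Theorems.Prop7OneFormAgmonBilinear

end
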